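import Summits.BirchSwinnertonDyer.BirchSwinnertonDyer.Theorems.SylvesterTwoHeegnerIndexCMHalfThmCOfInvolutionFixing
import Summits.BirchSwinnertonDyer.BirchSwinnertonDyer.Theorems.SylvesterTwoHeegnerIndexCMHalfLayerL1OfInvolutionFixing
import Summits.BirchSwinnertonDyer.Rank1Residual.X11b.KolyvaginTowerLiftConcrete
import HarnessLib

/-!
# (S10e) of leaf (L1) at `p ≡ 7 (mod 9)`, crux `UpperOffV0HSYPlus` (stmt-BirchSwinnertonDyer-19804): THE BOTTOM (W2-b) CLAUSE
# IS THE LEVEL CLAUSE AT `n = 1` — one displayed formula suffices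

Planner D552 records the node wording for ASK #2 (ρ3) as `∀ deg-6 Dt, hW2b₁ ∧ hW2b` (bottom clause on `K[9p]` ∧ level clause on
`K[9pn]`, Kolyvagin `n`).  The level clause already covers `n = 1` (`1 ≠ 0`, no prime factors): transporting along the mutual
inclusions `K[9p] ≤ K[9p·1] ≤ K[9p]` (equal subfields of `ℂ`) gives `hW2b → hW2b₁`, so the node may be worded with the SINGLE
display `∀ deg-6 Dt, hW2b`.

* `involutionFixing_bottom_of_level (Dt) : hW2b → hW2b₁` — for `τ, s` at the bottom, the automorphism `φ := ι ∘ s ∘ ι⁻¹` of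
  `K[9p·1]` is an involution realised by the same `τ` along `e ∘ ι⁻¹`, so `hW2b` (n = 1) fixes `ι(y₁)`, and `ι` is injective on
  points (Mathlib `Affine.Point.map_map` / `map_injective`, tree `map_toRatAlgHom_map_inclusion`);
* `thmC_of_named_of_levelInvolutionFixing (Dt) (hdeg) (hD) (hW2b)` (= `stub_thmC`'s type) and
  `layerL1Seven_of_named_of_flip_of_levelInvolutionFixing (Dt) (hdeg) (hD) (hES2) (hW2b)` (= `stub_layerL1Seven`'s type VERBATIM):
  the two stubs behind the ONE display `hW2b` (p690231 / p689963 fed with the above).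

HONEST LABEL: CONDITIONAL; `hW2b` is the unrefereed cell lemma (W2-b) (memo two §67.2; desk (M-K3-7)); no ledger stub closed; items
19802/19804 OPEN; X12.CMAtTwo NOT proved; BSD is not proved by any of this, for any curve.  `--supports stmt-BirchSwinnertonDyer-19804
--as helper`.
-/

set_option linter.dupNamespace false
set_option autoImplicit false

noncomputable section

open scoped Classical Pointwise

namespace Summit.BirchSwinnertonDyer.BirchSwinnertonDyer.Theorems.SylvesterTwoCMHalf

open WeierstrassCurve Field NumberField IsDedekindDomain IsDedekindDomain.HeightOneSpectrum Finset Module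
open Literature.NumberTheory.EllipticCurves Literature.NumberTheory.GaloisRepresentations
  Literature.NumberTheory.EllipticCurves.ModularForms
  Literature.NumberTheory.EllipticCurves.HuShuYin2019
  Literature.NumberTheory.EllipticCurves.KolyvaginCocycle
  Literature.NumberTheory.EllipticCurves.RingClassField
  Summit.BirchSwinnertonDyer.BirchSwinnertonDyer.Theses.SylvesterTwoHeegnerIndex
  Summit.BirchSwinnertonDyer.BirchSwinnertonDyer.Theorems
  Summit.BirchSwinnertonDyer.BirchSwinnertonDyer.Theorems.SylvesterTwoCoupledDescentCebotarev
  Summit.BirchSwinnertonDyer.BirchSwinnertonDyer.Theorems.SylvesterTwoCMData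
  Summit.BirchSwinnertonDyer.BirchSwinnertonDyer.Theorems.SylvesterTwoCMFlip
  Summit.BirchSwinnertonDyer.Rank1Residual.X11b Summit.BirchSwinnertonDyer.Rank1Residual.X11b.RingClassTower

set_option maxHeartbeats 1600000 in
/-- **`hW2b → hW2b₁`: the bottom clause is the level clause at `n = 1`** (transport along `K[9p] ≅ K[9p·1]`).
[cite: GrossLMS1991, §3 (K_1 = K[1])] [cite: HuShuYin2019, §4.1 p. 10] -/
theorem involutionFixing_bottom_of_level
    (Dt : ModularParametrizationData (⟨0, 0, 1, 0, -1⟩ : WeierstrassCurve ℚ) 243)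
    (hW2b : ∀ (p : ℕ), p.Prime → p % 9 = 7 → ∀ (K : Type) [Field K] [NumberField K] (ω : K), ω ^ 2 + ω + 1 = 0 →
      Module.finrank ℚ K = 2 → ∀ (ι : K →+* ℂ) (v : HeightOneSpectrum (𝓞 K)), ((3 : ℕ) : 𝓞 K) ∈ v.asIdeal →
      ∀ (n : ℕ), n ≠ 0 → (∀ q ∈ n.primeFactors, q % 3 = 2) →
      ∀ (e : ringClassField K ι (9 * p * n) →+* AlgebraicClosure K),
        (∀ k : K, e (algebraMap K (ringClassField K ι (9 * p * n)) k) = algebraMap K (AlgebraicClosure K) k) →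
      ∀ (y : ((⟨0, 0, 1, 0, -1⟩ : WeierstrassCurve ℚ).baseChange (ringClassField K ι (9 * p * n))).toAffine.Point),
        Affine.Point.map (W' := (⟨0, 0, 1, 0, -1⟩ : WeierstrassCurve ℚ)) (ringClassField K ι (9 * p * n)).subtype.toRatAlgHom y =
          Dt.φ (heegnerTau ((n : ℤ) ^ 2 * (81 * ((p : ℤ) ^ 2 + 4 * p + 16)),
            (n : ℤ) * (-(9 * (4 * (p : ℤ) ^ 2 + 17 * p + 72))), 4 * (p : ℤ) ^ 2 + 18 * p + 81)) →
      ∀ (τ : absoluteGaloisGroup (v.adicCompletion K))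
        (φ : ringClassField K ι (9 * p * n) ≃ₐ[K] ringClassField K ι (9 * p * n)),
        (∀ x : ringClassField K ι (9 * p * n), (show AlgebraicClosure K ≃ₐ[K] AlgebraicClosure K from
          resGal (K := K) (v.adicCompletion K) τ) (e x) = e (φ x)) → φ * φ = 1 →
        pointGalHom (⟨0, 0, 1, 0, -1⟩ : WeierstrassCurve ℚ) (ringClassField K ι (9 * p * n)) (φ.restrictScalars ℚ) y = y) :
    ∀ (p : ℕ), p.Prime → p % 9 = 7 → ∀ (K : Type) [Field K] [NumberField K] (ω : K), ω ^ 2 + ω + 1 = 0 →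
      Module.finrank ℚ K = 2 → ∀ (ι : K →+* ℂ) (v : HeightOneSpectrum (𝓞 K)), ((3 : ℕ) : 𝓞 K) ∈ v.asIdeal →
      ∀ (e : ringClassField K ι (9 * p) →+* AlgebraicClosure K),
        (∀ k : K, e (algebraMap K (ringClassField K ι (9 * p)) k) = algebraMap K (AlgebraicClosure K) k) →
      ∀ (y₁ : ((⟨0, 0, 1, 0, -1⟩ : WeierstrassCurve ℚ).baseChange (ringClassField K ι (9 * p))).toAffine.Point),
        Affine.Point.map (W' := (⟨0, 0, 1, 0, -1⟩ : WeierstrassCurve ℚ)) (ringClassField K ι (9 * p)).subtype.toRatAlgHom y₁ =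
          Dt.φ (heegnerTau (81 * ((p : ℤ) ^ 2 + 4 * p + 16), -(9 * (4 * (p : ℤ) ^ 2 + 17 * p + 72)), 4 * (p : ℤ) ^ 2 + 18 * p + 81)) →
      ∀ (τ : absoluteGaloisGroup (v.adicCompletion K)) (s : ringClassField K ι (9 * p) ≃ₐ[K] ringClassField K ι (9 * p)),
        (∀ x : ringClassField K ι (9 * p), (show AlgebraicClosure K ≃ₐ[K] AlgebraicClosure K from
          resGal (K := K) (v.adicCompletion K) τ) (e x) = e (s x)) → s * s = 1 →
        pointGalHom (⟨0, 0, 1, 0, -1⟩ : WeierstrassCurve ℚ) (ringClassField K ι (9 * p)) (s.restrictScalars ℚ) y₁ = y₁ := by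
  intro p hp hp7 K _ _ ω hω h2 ι v hv e₀ he₀ y₁ hy₁ τ s hacts hs2
  have hK := JZero.isImaginaryQuadratic_of_sq_add_self_add_one hω h2
  have hp0 : p ≠ 0 := hp.ne_zero
  have h9p0 : 9 * p ≠ 0 := mul_ne_zero (by norm_num) hp0
  have h9p10 : 9 * p * 1 ≠ 0 := by rw [mul_one]; exact h9p0
  haveI := (finiteDimensional_and_isGalois_ringClassField hK ι h9p0).1
  haveI := (finiteDimensional_and_isGalois_ringClassField hK ι h9p0).2
  haveI := (finiteDimensional_and_isGalois_ringClassField hK ι h9p10).1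
  haveI := (finiteDimensional_and_isGalois_ringClassField hK ι h9p10).2
  -- ### the mutual inclusions `K[9p] ≤ K[9p·1] ≤ K[9p]`
  have hle : ringClassField K ι (9 * p) ≤ ringClassField K ι (9 * p * 1) :=
    ringClassField_mono hK ι (Dvd.intro 1 rfl) h9p10
  have hge : ringClassField K ι (9 * p * 1) ≤ ringClassField K ι (9 * p) :=
    ringClassField_mono hK ι (Dvd.intro 1 (by ring)) h9p0
  set iup := RingClassField.inclusion ι hle with hiup
  set idn := RingClassField.inclusion ι hge with hidn
  have hud : ∀ x, idn (iup x) = x := fun x ↦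
    Subtype.ext (by rw [hidn, hiup, RingClassField.coe_inclusion, RingClassField.coe_inclusion])
  have hdu : ∀ z, iup (idn z) = z := fun z ↦
    Subtype.ext (by rw [hidn, hiup, RingClassField.coe_inclusion, RingClassField.coe_inclusion])
  -- ### the embedding `e₁ = e₀ ∘ idn` of `K[9p·1]` and the transported point `y = iup(y₁)`
  set e₁ : ringClassField K ι (9 * p * 1) →+* AlgebraicClosure K := e₀.comp (idn : _ →+* _) with he₁def
  have he₁ : ∀ k : K, e₁ (algebraMap K (ringClassField K ι (9 * p * 1)) k) = algebraMap K (AlgebraicClosure K) k := fun k ↦ by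
    show e₀ (idn (algebraMap K (ringClassField K ι (9 * p * 1)) k)) = _
    rw [idn.commutes, he₀]
  set y := Affine.Point.map (W' := (⟨0, 0, 1, 0, -1⟩ : WeierstrassCurve ℚ)) (iup.restrictScalars ℚ) y₁ with hydef
  have hy : Affine.Point.map (W' := (⟨0, 0, 1, 0, -1⟩ : WeierstrassCurve ℚ)) (ringClassField K ι (9 * p * 1)).subtype.toRatAlgHom y =
      Dt.φ (heegnerTau ((((1 : ℕ) : ℤ)) ^ 2 * (81 * ((p : ℤ) ^ 2 + 4 * p + 16)),
        ((1 : ℕ) : ℤ) * (-(9 * (4 * (p : ℤ) ^ 2 + 17 * p + 72))), 4 * (p : ℤ) ^ 2 + 18 * p + 81)) := by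
    rw [Nat.cast_one, one_pow, one_mul, one_mul, ← hy₁, hydef, hiup]
    exact map_toRatAlgHom_map_inclusion (W := (⟨0, 0, 1, 0, -1⟩ : WeierstrassCurve ℚ)) ι hle
      (ringClassField K ι (9 * p * 1)).subtype (ringClassField K ι (9 * p)).subtype
      (fun x' ↦ RingClassField.coe_inclusion ι hle x') y₁
  -- ### the transported involution `φ = iup ∘ s ∘ idn`
  set ε : ringClassField K ι (9 * p) ≃ₐ[K] ringClassField K ι (9 * p * 1) :=
    AlgEquiv.ofAlgHom iup idn (AlgHom.ext hdu) (AlgHom.ext hud) with hεdef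
  set φ : ringClassField K ι (9 * p * 1) ≃ₐ[K] ringClassField K ι (9 * p * 1) := ε.symm.trans (s.trans ε) with hφdef
  have hφ : ∀ z, φ z = iup (s (idn z)) := fun _ ↦ rfl
  have hφacts : ∀ z : ringClassField K ι (9 * p * 1), (show AlgebraicClosure K ≃ₐ[K] AlgebraicClosure K from
      resGal (K := K) (v.adicCompletion K) τ) (e₁ z) = e₁ (φ z) := by
    intro z
    show (show AlgebraicClosure K ≃ₐ[K] AlgebraicClosure K from resGal (K := K) (v.adicCompletion K) τ) (e₀ (idn z)) =
      e₀ (idn (φ z))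
    rw [hacts, hφ, hud]
  have hφ2 : φ * φ = 1 := by
    refine AlgEquiv.ext fun z ↦ ?_
    rw [AlgEquiv.mul_apply, hφ, hφ, hud, ← AlgEquiv.mul_apply, hs2, AlgEquiv.one_apply, hdu, AlgEquiv.one_apply]
  -- ### (W2-b) at level `n = 1`, pulled back along `iup`
  have hfix := hW2b p hp hp7 K ω hω h2 ι v hv 1 one_ne_zero (fun q hq ↦ by simp [Nat.primeFactors_one] at hq)
    e₁ he₁ y hy τ φ hφacts hφ2
  have hcomp : (iup.restrictScalars ℚ).comp
        ((s.restrictScalars ℚ : ringClassField K ι (9 * p) ≃ₐ[ℚ] ringClassField K ι (9 * p)) :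
          ringClassField K ι (9 * p) →ₐ[ℚ] ringClassField K ι (9 * p)) =
      (((φ.restrictScalars ℚ : ringClassField K ι (9 * p * 1) ≃ₐ[ℚ] ringClassField K ι (9 * p * 1)) :
          ringClassField K ι (9 * p * 1) →ₐ[ℚ] ringClassField K ι (9 * p * 1))).comp (iup.restrictScalars ℚ) :=
    AlgHom.ext fun x ↦ by
      show iup (s x) = φ (iup x)
      rw [hφ, hud]
  have key : Affine.Point.map (W' := (⟨0, 0, 1, 0, -1⟩ : WeierstrassCurve ℚ)) (iup.restrictScalars ℚ)
        (pointGalHom (⟨0, 0, 1, 0, -1⟩ : WeierstrassCurve ℚ) (ringClassField K ι (9 * p)) (s.restrictScalars ℚ) y₁) =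
      Affine.Point.map (W' := (⟨0, 0, 1, 0, -1⟩ : WeierstrassCurve ℚ)) (iup.restrictScalars ℚ) y₁ := by
    rw [pointGalHom_apply, Affine.Point.map_map, hcomp, ← Affine.Point.map_map, ← hydef, ← pointGalHom_apply]
    exact hfix
  exact Affine.Point.map_injective _ key

/-- **`stub_thmC` behind the ONE display `hW2b`** (= p690231 `thmC_of_named_of_involutionFixing` ∘ `involutionFixing_bottom_of_level`).
CONDITIONAL; item 19802 stays open; BSD is not proved by any of this. [cite: HuShuYin2019, display (bsd) p. 12, §3 p. 8] -/
theorem thmC_of_named_of_levelInvolutionFixing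
    (Dt : ModularParametrizationData (⟨0, 0, 1, 0, -1⟩ : WeierstrassCurve ℚ) 243) (hdeg : Dt.deg = 6)
    (hD : shaAnPair_mul_height_eq_two_zpow_mul_height_named)
    (hW2b : ∀ (p : ℕ), p.Prime → p % 9 = 7 → ∀ (K : Type) [Field K] [NumberField K] (ω : K), ω ^ 2 + ω + 1 = 0 →
      Module.finrank ℚ K = 2 → ∀ (ι : K →+* ℂ) (v : HeightOneSpectrum (𝓞 K)), ((3 : ℕ) : 𝓞 K) ∈ v.asIdeal →
      ∀ (n : ℕ), n ≠ 0 → (∀ q ∈ n.primeFactors, q % 3 = 2) →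
      ∀ (e : ringClassField K ι (9 * p * n) →+* AlgebraicClosure K),
        (∀ k : K, e (algebraMap K (ringClassField K ι (9 * p * n)) k) = algebraMap K (AlgebraicClosure K) k) →
      ∀ (y : ((⟨0, 0, 1, 0, -1⟩ : WeierstrassCurve ℚ).baseChange (ringClassField K ι (9 * p * n))).toAffine.Point),
        Affine.Point.map (W' := (⟨0, 0, 1, 0, -1⟩ : WeierstrassCurve ℚ)) (ringClassField K ι (9 * p * n)).subtype.toRatAlgHom y =
          Dt.φ (heegnerTau ((n : ℤ) ^ 2 * (81 * ((p : ℤ) ^ 2 + 4 * p + 16)),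
            (n : ℤ) * (-(9 * (4 * (p : ℤ) ^ 2 + 17 * p + 72))), 4 * (p : ℤ) ^ 2 + 18 * p + 81)) →
      ∀ (τ : absoluteGaloisGroup (v.adicCompletion K))
        (φ : ringClassField K ι (9 * p * n) ≃ₐ[K] ringClassField K ι (9 * p * n)),
        (∀ x : ringClassField K ι (9 * p * n), (show AlgebraicClosure K ≃ₐ[K] AlgebraicClosure K from
          resGal (K := K) (v.adicCompletion K) τ) (e x) = e (φ x)) → φ * φ = 1 →
        pointGalHom (⟨0, 0, 1, 0, -1⟩ : WeierstrassCurve ℚ) (ringClassField K ι (9 * p * n)) (φ.restrictScalars ℚ) y = y) :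
    PublishedFactsTwoPlus → SylvesterTwoNonneg.HSYPointTwoDivisibleSevenModNine :=
  thmC_of_named_of_involutionFixing Dt hdeg hD (involutionFixing_bottom_of_level Dt hW2b)

set_option maxHeartbeats 1600000 in
/-- **`stub_layerL1Seven` behind the ONE display `hW2b`** (= p689963 `layerL1Seven_of_named_of_flip_of_involutionFixing` ∘
`involutionFixing_bottom_of_level`): the stub's type VERBATIM.  CONDITIONAL; the ledger stub stays open; BSD is not proved by any of
this. [cite: HuShuYin2019, Thm. 1.4, §2 Prop. 2.4 / Cor. 2.5, §3 p. 8, §4.1] [cite: GrossLMS1991, §3–§6] [cite: Nekovar2007, Prop. 4.9] -/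
theorem layerL1Seven_of_named_of_flip_of_levelInvolutionFixing
    (Dt : ModularParametrizationData (⟨0, 0, 1, 0, -1⟩ : WeierstrassCurve ℚ) 243) (hdeg : Dt.deg = 6)
    (hD : shaAnPair_mul_height_eq_two_zpow_mul_height_named)
    (hES2 : Nekovar2007.cmPoint_frobeniusCongruence)
    (hW2b : ∀ (p : ℕ), p.Prime → p % 9 = 7 → ∀ (K : Type) [Field K] [NumberField K] (ω : K), ω ^ 2 + ω + 1 = 0 →
      Module.finrank ℚ K = 2 → ∀ (ι : K →+* ℂ) (v : HeightOneSpectrum (𝓞 K)), ((3 : ℕ) : 𝓞 K) ∈ v.asIdeal →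
      ∀ (n : ℕ), n ≠ 0 → (∀ q ∈ n.primeFactors, q % 3 = 2) →
      ∀ (e : ringClassField K ι (9 * p * n) →+* AlgebraicClosure K),
        (∀ k : K, e (algebraMap K (ringClassField K ι (9 * p * n)) k) = algebraMap K (AlgebraicClosure K) k) →
      ∀ (y : ((⟨0, 0, 1, 0, -1⟩ : WeierstrassCurve ℚ).baseChange (ringClassField K ι (9 * p * n))).toAffine.Point),
        Affine.Point.map (W' := (⟨0, 0, 1, 0, -1⟩ : WeierstrassCurve ℚ)) (ringClassField K ι (9 * p * n)).subtype.toRatAlgHom y =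
          Dt.φ (heegnerTau ((n : ℤ) ^ 2 * (81 * ((p : ℤ) ^ 2 + 4 * p + 16)),
            (n : ℤ) * (-(9 * (4 * (p : ℤ) ^ 2 + 17 * p + 72))), 4 * (p : ℤ) ^ 2 + 18 * p + 81)) →
      ∀ (τ : absoluteGaloisGroup (v.adicCompletion K))
        (φ : ringClassField K ι (9 * p * n) ≃ₐ[K] ringClassField K ι (9 * p * n)),
        (∀ x : ringClassField K ι (9 * p * n), (show AlgebraicClosure K ≃ₐ[K] AlgebraicClosure K from
          resGal (K := K) (v.adicCompletion K) τ) (e x) = e (φ x)) → φ * φ = 1 →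
        pointGalHom (⟨0, 0, 1, 0, -1⟩ : WeierstrassCurve ℚ) (ringClassField K ι (9 * p * n)) (φ.restrictScalars ℚ) y = y) :
    SylvesterTwoNonneg.HSYPointTwoDivisibleSevenModNine →
    (PublishedFactsTwoPlus →
      ∀ (p : ℕ), p.Prime → p % 9 = 7 → (¬ ∃ x : ZMod p, x ^ 3 = 3) →
        ∀ (A B : WeierstrassCurve ℚ) [A.IsElliptic] [A.IsGloballyMinimal] [B.IsElliptic]
          [B.IsGloballyMinimal], (∃ C : VariableChange ℚ, C • B = HuShuYin2019.cubeSumCurve (p : ℚ)) →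
          (∃ C : VariableChange ℚ, C • A = HuShuYin2019.cubeSumCurve (3 * (p : ℚ) ^ 2)) →
          ∀ (qB qA : ℚ), shaAn B = (qB : ℂ) → shaAn A = (qA : ℂ) → qB * qA ≠ 0 →
            padicValRat 2 (qB * qA) = 0 →
            ∀ (K : Type) [Field K] [NumberField K] (ω : K), ω ^ 2 + ω + 1 = 0 →
              Module.finrank ℚ K = 2 →
            ∀ Y₀ : ((cubeSumCurve (p : ℚ)).baseChange K).toAffine.Point,
              (¬ ∃ Q : ((cubeSumCurve (p : ℚ)).baseChange K).toAffine.Point, (2 : ℕ) • Q = Y₀) →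
            ∃ (cA : ℕ → galH1Torsion ((cubeSumCurve (3 * (p : ℚ) ^ 2)).baseChange K) (2 : ℕ))
              (cB : ℕ → galH1Torsion ((cubeSumCurve (p : ℚ)).baseChange K) (2 : ℕ)),
            (∀ ℓ, (ℓ.Prime ∧ ¬ ℓ ∣ (cubeSumCurve (3 * (p : ℚ) ^ 2)).conductorNorm ℤ ∧
                ¬ ℓ ∣ (cubeSumCurve (p : ℚ)).conductorNorm ℤ ∧ ¬ ((ℓ : ℤ) ∣ NumberField.discr K) ∧ ℓ ≠ 2 ∧
                (Ideal.span {(ℓ : 𝓞 K)}).IsPrime ∧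
                FrobEqFrobInfty (cubeSumCurve (3 * (p : ℚ) ^ 2)) K 2 ℓ ∧
                FrobEqFrobInfty (cubeSumCurve (p : ℚ)) K 2 ℓ) →
              (∀ v : HeightOneSpectrum (𝓞 K), (ℓ : 𝓞 K) ∉ v.asIdeal →
                cA ℓ ∈ selmerLocalKer ((cubeSumCurve (3 * (p : ℚ) ^ 2)).baseChange K)
                  (v.adicCompletion K) (2 : ℕ)) ∧
              (∀ x : InfinitePlace K, cA ℓ ∈ selmerLocalKer
                ((cubeSumCurve (3 * (p : ℚ) ^ 2)).baseChange K) x.Completion (2 : ℕ)) ∧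
              (∀ v : HeightOneSpectrum (𝓞 K), (ℓ : 𝓞 K) ∈ v.asIdeal →
                (cA ℓ ∈ selmerLocalKer ((cubeSumCurve (3 * (p : ℚ) ^ 2)).baseChange K)
                    (v.adicCompletion K) (2 : ℕ) ↔
                  kummerClassOfPoint (cubeSumCurve (p : ℚ)) K Nat.prime_two Y₀ ∈
                    ((cubeSumCurve (p : ℚ)).baseChange K).torsionLocalKer (v.adicCompletion K) (2 : ℕ)))) ∧
            (∀ ℓ ℓ', (ℓ.Prime ∧ ¬ ℓ ∣ (cubeSumCurve (3 * (p : ℚ) ^ 2)).conductorNorm ℤ ∧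
                ¬ ℓ ∣ (cubeSumCurve (p : ℚ)).conductorNorm ℤ ∧ ¬ ((ℓ : ℤ) ∣ NumberField.discr K) ∧ ℓ ≠ 2 ∧
                (Ideal.span {(ℓ : 𝓞 K)}).IsPrime ∧
                FrobEqFrobInfty (cubeSumCurve (3 * (p : ℚ) ^ 2)) K 2 ℓ ∧
                FrobEqFrobInfty (cubeSumCurve (p : ℚ)) K 2 ℓ) →
              (ℓ'.Prime ∧ ¬ ℓ' ∣ (cubeSumCurve (3 * (p : ℚ) ^ 2)).conductorNorm ℤ ∧
                ¬ ℓ' ∣ (cubeSumCurve (p : ℚ)).conductorNorm ℤ ∧ ¬ ((ℓ' : ℤ) ∣ NumberField.discr K) ∧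
                ℓ' ≠ 2 ∧ (Ideal.span {(ℓ' : 𝓞 K)}).IsPrime ∧
                FrobEqFrobInfty (cubeSumCurve (3 * (p : ℚ) ^ 2)) K 2 ℓ' ∧
                FrobEqFrobInfty (cubeSumCurve (p : ℚ)) K 2 ℓ') → ℓ ≠ ℓ' →
              (∀ v : HeightOneSpectrum (𝓞 K), (ℓ : 𝓞 K) ∉ v.asIdeal → (ℓ' : 𝓞 K) ∉ v.asIdeal →
                cB (ℓ * ℓ') ∈ selmerLocalKer ((cubeSumCurve (p : ℚ)).baseChange K)
                  (v.adicCompletion K) (2 : ℕ)) ∧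
              (∀ x : InfinitePlace K,
                cB (ℓ * ℓ') ∈ selmerLocalKer ((cubeSumCurve (p : ℚ)).baseChange K) x.Completion (2 : ℕ)) ∧
              (∀ v : HeightOneSpectrum (𝓞 K), (ℓ : 𝓞 K) ∈ v.asIdeal →
                (cB (ℓ * ℓ') ∈ selmerLocalKer ((cubeSumCurve (p : ℚ)).baseChange K)
                    (v.adicCompletion K) (2 : ℕ) ↔
                  cA ℓ' ∈ ((cubeSumCurve (3 * (p : ℚ) ^ 2)).baseChange K).torsionLocalKer
                    (v.adicCompletion K) (2 : ℕ))))) :=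
  layerL1Seven_of_named_of_flip_of_involutionFixing Dt hdeg hD hES2 (involutionFixing_bottom_of_level Dt hW2b) hW2b

end Summit.BirchSwinnertonDyer.BirchSwinnertonDyer.Theorems.SylvesterTwoCMHalf

end
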